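import Mathlib
import HarnessLib
import Summits.ResolutionOfSingularities.ResolutionOfSingularities.Theorems.WildQuotientsWildQuotientResolutionS1aKillCharts

/-!
# S1a — AGREEMENT OF FILTRATIONS IS LOCAL: it suffices to check it on one affine neighbourhood of each point of the overlap

[OURS · L1 W4.5c · lead-1 g9] — NOT statements of the manuscript; counted 0; AI-level work, weaker than expert review. Crux
stmt-ResolutionOfSingularities-17941, line `s1a-logminvertex` v9; serves the K cut `KillChartsReach` (…S1aKillCharts, p624220). Route-independent.

The agreement clause of `KillChartsReach` / `KillAgreeReach` asks `𝒦ᵢ = 𝒦ₖ` on EVERY affine open inside `Oᵢ ∩ Oₖ`. Ideal sheaves are determined stalkwise,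
so it suffices that every point of `Oᵢ ∩ Oₖ` has ONE affine neighbourhood on which the two filtrations agree (e.g. the finitely many charts a census
certificate checks):
* `ideal_eq_of_locally_eq` — two ideal sheaf data that agree on some affine neighbourhood of every point of an affine `U` agree on `U`
  (Mathlibʼs `IsAffineOpen.ideal_ext_iff` + `exists_basicOpen_le_affine_inter` + `map_ideal_basicOpen`);
* ★ `agree_of_locally_agree` — the agreement clause of the K cut from pointwise-local agreement on the overlap;
* `killChartsReach_of_local` — `KillChartsReach` with the agreement clause in the local form implies `KillChartsReach`.
-/

set_option linter.dupNamespace false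

noncomputable section

universe u

open CategoryTheory Limits AlgebraicGeometry TopologicalSpace Topology Opposite
open Literature.AlgebraicGeometry.Resolution Literature.AlgebraicGeometry.RelativeSpec
open Summit.ResolutionOfSingularities.ResolutionOfSingularities.Theorems.WildQuotientResolution.S1
open Summit.ResolutionOfSingularities.ResolutionOfSingularities.Theorems.WildQuotientResolution.S1.NodeAtlas
open Summit.ResolutionOfSingularities.ResolutionOfSingularities.Theorems.WildQuotientResolution.S1.KillCharts

namespace Summit.ResolutionOfSingularities.ResolutionOfSingularities.Theorems.WildQuotientResolution.S1.LocalAgree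

section Sheaf

variable {X : Scheme.{u}}

/-- **Two ideal sheaves that agree on some affine neighbourhood of every point of an affine open agree on it** (ideals of sections of a
quasi-coherent ideal sheaf are determined by their stalks). [OURS · L1 W4.5c] -/
theorem ideal_eq_of_locally_eq (K₁ K₂ : X.IdealSheafData) (U : X.affineOpens)
    (h : ∀ x ∈ (U.1 : Set X), ∃ W : X.affineOpens, x ∈ (W.1 : Set X) ∧ K₁.ideal W = K₂.ideal W) : K₁.ideal U = K₂.ideal U := by
  rw [U.2.ideal_ext_iff]
  intro x hxU
  obtain ⟨W, hxW, hW⟩ := h x hxU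
  obtain ⟨f, g, hfg, hxf⟩ := exists_basicOpen_le_affine_inter U.2 W.2 x ⟨hxU, hxW⟩
  -- `K₁` and `K₂` agree on the basic open `D(f) = D(g)`
  have e : X.affineBasicOpen g = X.affineBasicOpen f := Subtype.ext hfg.symm
  have hg : K₁.ideal (X.affineBasicOpen g) = K₂.ideal (X.affineBasicOpen g) := by
    rw [← K₁.map_ideal_basicOpen, ← K₂.map_ideal_basicOpen, hW]
  have hf' : K₁.ideal (X.affineBasicOpen f) = K₂.ideal (X.affineBasicOpen f) := e ▸ hg
  have h1 : (K₁.ideal U).map (X.presheaf.map (homOfLE <| X.basicOpen_le f).op).hom =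
      (K₂.ideal U).map (X.presheaf.map (homOfLE <| X.basicOpen_le f).op).hom := by
    rw [K₁.map_ideal_basicOpen, K₂.map_ideal_basicOpen]
    exact hf'
  apply_fun Ideal.map (X.presheaf.germ (X.basicOpen f) x hxf).hom at h1
  simp only [Ideal.map_map, ← CommRingCat.hom_comp, X.presheaf.germ_res] at h1
  exact h1

end Sheaf

section Filtration

variable {V : Scheme.{u}}

/-- ★ **AGREEMENT IS LOCAL ON THE OVERLAP**: if every point of `O₁ ∩ O₂` has an affine neighbourhood on which the Rees filtrations `𝒦₁`, `𝒦₂` agree, then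
they agree on every affine open inside `O₁ ∩ O₂` (the agreement clause of `KillChartsReach` / `KillAgreeReach`). [OURS · L1 W4.5c] -/
theorem agree_of_locally_agree (𝒦₁ 𝒦₂ : ReesFiltration V) (O₁ O₂ : V.Opens)
    (h : ∀ x ∈ ((O₁ ⊓ O₂ : V.Opens) : Set V), ∃ W : V.affineOpens, x ∈ (W.1 : Set V) ∧
      ∀ n, (𝒦₁.filtration W).ideal n = (𝒦₂.filtration W).ideal n)
    (U : V.affineOpens) (h₁ : U.1 ≤ O₁) (h₂ : U.1 ≤ O₂) (n : ℕ) : (𝒦₁.filtration U).ideal n = (𝒦₂.filtration U).ideal n := by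
  rw [ReesFiltration.filtration_ideal, ReesFiltration.filtration_ideal]
  refine ideal_eq_of_locally_eq _ _ U fun x hx => ?_
  obtain ⟨W, hxW, hW⟩ := h x ⟨h₁ hx, h₂ hx⟩
  refine ⟨W, hxW, ?_⟩
  have := hW n
  rwa [ReesFiltration.filtration_ideal, ReesFiltration.filtration_ideal] at this

end Filtration

/-! ## `KillChartsReach` with local agreement -/

variable {p : ℕ}

/-- **`KillChartsReach` from the LOCAL agreement clause**: if at every reachable all-killable model there are finitely many principal kill charts of one
degree covering the closures of their supports, one containing a bad point, such that every point of each overlap `Oᵢ ∩ Oⱼ` has an affine neighbourhood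
on which `𝒦ᵢ` and `𝒦ⱼ` agree, then `KillChartsReach p`. [OURS · L1 W4.5c] -/
theorem killChartsReach_of_local
    (h : ∀ (k : Type) [Field k] [CharP k p] [PerfectField k] (X' X₁ : Scheme.{0})
      (f : X₁ ⟶ Spec (.of k)) (q : X' ⟶ X₁) (G : Type) [Group G] [Finite G]
      (ρ : G →* Aut X'), Nat.card G = p → IsSeparated f → LocallyOfFiniteType f → QuasiCompact f →
      IsIntegral X₁ → ∀ [IsIntegral X'], Scheme.IsRegular X' → IsFinite q → Function.Surjective q.base →
      (∃ U : X₁.Opens, Dense (U : Set X₁) ∧ Etale (q ∣_ U)) →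
      ∀ (hq : ∀ g : G, (ρ g).hom ≫ q = q),
      (∀ x y : X', q.base x = q.base y → ∃ g : G, (ρ g).hom.base x = y) →
      topologicalKrullDim X₁ ≤ 4 → Function.Injective ρ →
      ∀ (g₀ : G), (∀ g : G, g ∈ Subgroup.zpowers g₀) → ∀ [IsLocallyNoetherian X']
        (h₀ : NodeAtlas p (⟨ρ, hq⟩ : ActionOver q G) g₀),
        ∀ M : GameFrame.GModel p q G ρ g₀, (GameFrame.GModel.initial hq h₀).Reachable M → ¬ M.Terminal → M.jInf = ⊥ →
          ∃ (n : ℕ) (O : Fin n → M.act.StableAffineOpens) (𝒦 : Fin n → ReesFiltration M.V) (d : ℕ), 0 < d ∧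
            (∀ i, IsPrincipalCentreChart p M.act g₀ (𝒦 i) d (O i)) ∧
            (∀ i j, ∀ x ∈ (((O i).1 ⊓ (O j).1 : M.V.Opens) : Set M.V), ∃ W : M.V.affineOpens, x ∈ (W.1 : Set M.V) ∧
              ∀ m, ((𝒦 i).filtration W).ideal m = ((𝒦 j).filtration W).ideal m) ∧
            (∀ i, closure ((((𝒦 i).ideal d).support : Set M.V) ∩ (O i).1) ⊆ ⋃ k, ((O k).1 : Set M.V)) ∧
            ∃ i, (M.badLocus ∩ (O i).1).Nonempty) :
    KillChartsReach p := by
  intro k _ _ _ X' X₁ f q G _ _ ρ hG hfs hfft hfqc hX₁ _ hreg hqfin hqs hqet hq horb hdim hinj g₀ hg₀ _ h₀ M hR hT hj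
  obtain ⟨n, O, 𝒦, d, hd, hprin, hloc, hcl, hbad⟩ :=
    h k X' X₁ f q G ρ hG hfs hfft hfqc hX₁ hreg hqfin hqs hqet hq horb hdim hinj g₀ hg₀ h₀ M hR hT hj
  exact ⟨n, O, 𝒦, d, hd, hprin, fun i j U hi hj' m => agree_of_locally_agree (𝒦 i) (𝒦 j) (O i).1 (O j).1 (hloc i j) U hi hj' m, hcl, hbad⟩

end Summit.ResolutionOfSingularities.ResolutionOfSingularities.Theorems.WildQuotientResolution.S1.LocalAgree

end
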